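import Mathlib
import HarnessLib
import Summits.NavierStokesRegularity.NavierStokesRegularity.Theorems.PoloidalWindowDoorLrcModEntireCurvedEndKill

/-!
# Route `PoloidalWindowDoor`, item `LrcModEntire` (stmt-NavierStokesRegularity-20428), cell (Q4-sonic, straight, μ < 0), case II —
# THE CURVED END′ IS EMPTY: the §6 tower kills the curvature of the base web (TOWER-CLOSES §E, assembly part 2)

Cell ns-regularity-ideate, helper seat ns-k2-port-2 g9 (assembly owner of END′ under the LEAD of item 20428, ns-poloidal-K2-p3 g17/g18);
`--supports stmt-NavierStokesRegularity-20428 --as helper`.  Memo `Cruxes/LrcModEntire/TOWER-CLOSES-port2g9.md` §E.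

★★★ `curvedEnd'_false` — THE HYPOTHESIS `hCurvedEnd′` OF `…CaseIIEntranceSharp.caseII_false_of_curvedEnd'`, VERBATIM, PROVED.  B-TWPc in one call
(`…FermiTimeWebAt.curved_timeWeb_at`, K2-p2 g18) gives a time window `τ*`; pick the base time `τ₁ := min(τ*, δ″)/2`, non-sonic by the punctured window;
by part 1 (`…CurvedEndKill.curvature_deriv_zero_at`) at every base point `k₁′ ≡ 0`, so the base web has constant curvature; it is the graph
`φ·e + n₀(τ₁,φ,0)·Je` with `φ` onto `ℝ`, so it is not a circle (`…PlanarCurveRigidity.line_or_circle_of_constant_curvature` + a two-line Cauchy–Schwarz),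
hence `k₁ ≡ 0`; then J3 of `curved_timeWeb_at` pins the base web, contradicting the LINE lever at the non-sonic time `τ₁`.

WHAT THIS IS NOT: not a claim about Navier–Stokes regularity.  It discharges the END′ hypothesis of the case-II reduction of the slot
`stub_Q4sonicLineNegIsolated` (registry twist_split v14): `caseII_false_of_curvedEnd' curvedEnd'_false` has the type of that slot; the registry step is the
LEAD's; items 20428 / 19708 / 27893 stay OPEN until then (bears_on LADDER-NS N0).
-/

noncomputable section

set_option linter.dupNamespace false
set_option linter.style.longLine false

namespace Summit.NavierStokesRegularity.NavierStokesRegularity.Theorems.PoloidalWindowDoorLrcModEntireCurvedEndTower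

open Set Function Filter Topology Metric
open scoped RealInnerProductSpace InnerProductSpace ContDiff Laplacian
open Literature.Analysis Literature.Analysis.FluidPDE Literature.Analysis.UnboundedOperators
open Summit.NavierStokesRegularity.NavierStokesRegularity.Theorems
open Summit.NavierStokesRegularity.NavierStokesRegularity.Theorems.LocalSineTubeDoorProfileAlignedWindowRigidityAncient
open Summit.NavierStokesRegularity.NavierStokesRegularity.Theorems.PoloidalWindowDoorPoloidalWindowRigidityWindow
open Summit.NavierStokesRegularity.NavierStokesRegularity.Theorems.PoloidalWindowDoorPoloidalWindowRigidityConstantShearSlice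
open Summit.NavierStokesRegularity.NavierStokesRegularity.Theorems.PoloidalWindowDoorPoloidalWindowRigidityTimeHeightShearLinearSlice
open Summit.NavierStokesRegularity.NavierStokesRegularity.Theorems.PoloidalWindowDoorLrcModEntireSheetFlattenTools
open Summit.NavierStokesRegularity.NavierStokesRegularity.Theorems.PoloidalWindowDoorLrcModEntireRidgeGlobalBranchODE
open Summit.NavierStokesRegularity.NavierStokesRegularity.Theorems.PoloidalWindowDoorLrcModEntireRidgeGlobalBranchFrame
open Summit.NavierStokesRegularity.NavierStokesRegularity.Theorems.PoloidalWindowDoorLrcModEntirePlanarCurveRigidity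
open Summit.NavierStokesRegularity.NavierStokesRegularity.Theorems.PoloidalWindowDoorLrcModEntireRidgeClassConstants
open Summit.NavierStokesRegularity.NavierStokesRegularity.Theorems.PoloidalWindowDoorLrcModEntireCurvedSheetJetLocal
open Summit.NavierStokesRegularity.NavierStokesRegularity.Theorems.PoloidalWindowDoorLrcModEntireCurvedTowerSheetForm
open Summit.NavierStokesRegularity.NavierStokesRegularity.Theorems.PoloidalWindowDoorLrcModEntireCurvedTowerKill
open Summit.NavierStokesRegularity.NavierStokesRegularity.Theorems.PoloidalWindowDoorLrcModEntireCurvedTimeSplitLocal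
open Summit.NavierStokesRegularity.NavierStokesRegularity.Theorems.PoloidalWindowDoorLrcModEntireQ4SonicHotSheetSecondPins (fderiv_fderiv_const_mul_apply)
open Summit.NavierStokesRegularity.NavierStokesRegularity.Theorems.PoloidalWindowDoorLrcModEntireFermiTimeWebAt
open Summit.NavierStokesRegularity.NavierStokesRegularity.Theorems.PoloidalWindowDoorLrcModEntirePeriodicSheetAtTime
open Summit.NavierStokesRegularity.NavierStokesRegularity.Theorems.PoloidalWindowDoorLrcModEntireCurvedEndKill

variable {C : ℝ} {U : ℝ → EuclideanSpace ℝ (Fin 3) → EuclideanSpace ℝ (Fin 3)}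

/-! ### 2. The curved END′ is empty -/

/-- ★★★ **THE CURVED END′ IS EMPTY** — the hypothesis `hCurvedEnd′` of `…CaseIIEntranceSharp.caseII_false_of_curvedEnd'`, VERBATIM.  At a base time
`0 < τ₁ < min(τ*, δ″)` (non-sonic by the punctured window): `k₁′ ≡ 0` by `curvature_deriv_zero_at` at every base point, so the base web has constant
curvature; it is the graph `φ·e + n₀(τ₁,φ,0)·Je` with `φ` onto `ℝ`, so it is not a circle, hence `k₁ ≡ 0`; J3 pins it, contradicting the LINE lever. -/
theorem curvedEnd'_false :
    ∀ (C σ κ ρ δ' r δ m : ℝ) (U : ℝ → EuclideanSpace ℝ (Fin 3) → EuclideanSpace ℝ (Fin 3)) (R μ : ℝ → ℝ → ℝ)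
          (e : EuclideanSpace ℝ (Fin 3)) (n₀ : ℝ × ℝ × ℝ → ℝ) (κt : ℝ → ℝ → ℝ),
          -- the hull element: class, hot value, Type-I hot bound, flat hot spot, time normalisation, peakless slices, critical hot set, (TH) structure
          Literature.Analysis.FluidPDE.HasTypeITimeDecay C U →
          ContinuousOn (Function.uncurry U) (Set.Iio (0 : ℝ) ×ˢ Set.univ) →
          (∀ s t : ℝ, s < t → t < 0 → ∀ x, U t x =
            Literature.Analysis.UnboundedOperators.heatExtension (U s) (t - s) x - Literature.Analysis.FluidPDE.oseenDuhamel 1 s U U t x) →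
          (∀ t < 0, Literature.Analysis.FluidPDE.VectorCalculus.IsDivFree (U t)) →
          (∀ s < 0, ∀ q, ⟪Literature.Analysis.FluidPDE.curl (U s) q, EuclideanSpace.single 2 1⟫_ℝ = 0) →
          U (-1) 0 2 ≠ 0 → (∀ t < 0, ∀ x, Real.sqrt (-t) * |U t x 2| ≤ |U (-1) 0 2|) →
          (∀ h : EuclideanSpace ℝ (Fin 3), fderiv ℝ (U (-1)) 0 h 2 = 0) →
          (deriv (fun s => U s 0 2) (-1) = U (-1) 0 2 / 2 ∧ U (-1) 0 2 * (Δ (fun q => U (-1) q 2)) 0 ≤ 0) →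
          (∀ (s z₀ σ M : ℝ) (K O : Set (EuclideanSpace ℝ (Fin 3))), s < 0 →
            ((σ = 1 ∨ σ = -1) ∧ IsCompact K ∧ K.Nonempty ∧ (∀ q ∈ K, q 2 = z₀ ∧ σ * U s q 2 = M) ∧
              IsOpen O ∧ K ⊆ O ∧ (∀ q ∈ O, q 2 = z₀ → σ * U s q 2 ≤ M) ∧
              (∀ q ∈ O, q 2 = z₀ → σ * U s q 2 = M → q ∈ K)) → False) →
          (∀ y ∈ {y : EuclideanSpace ℝ (Fin 3) | y 2 = 0 ∧ U (-1) y 2 = U (-1) 0 2}, fderiv ℝ (fun x => U (-1) x 2) y = 0) →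
          (∀ t < 0, ∀ x x' : EuclideanSpace ℝ (Fin 3), x 2 = x' 2 → ∀ b c : Fin 3, b ≠ 2 → c ≠ 2 →
            fderiv ℝ (U t) x (EuclideanSpace.single 2 1) b * fderiv ℝ (U t) x' (EuclideanSpace.single c 1) 2 =
              fderiv ℝ (U t) x' (EuclideanSpace.single 2 1) c * fderiv ℝ (U t) x (EuclideanSpace.single b 1) 2) →
          (∀ s < 0, ∀ y, ⟪fderiv ℝ (U s) y (Literature.Analysis.FluidPDE.curl (U s) y), EuclideanSpace.single 2 1⟫_ℝ = 0) →
          -- sign, curvature scale, slope function, slab law (pointwise and eventually form), radii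
          (σ = 1 ∨ σ = -1) → σ * U (-1) 0 2 = |U (-1) 0 2| → 0 < κ → ContDiff ℝ 3 (Function.uncurry μ) → 0 < ρ → ρ ≤ 1 →
          (∀ t : ℝ, |t + 1| < ρ → ∀ x : EuclideanSpace ℝ (Fin 3), |x 2| < ρ → ∀ b : Fin 3, b ≠ 2 →
            fderiv ℝ (U t) x (EuclideanSpace.single 2 1) b = μ t (x 2) * fderiv ℝ (U t) x (EuclideanSpace.single b 1) 2) →
          (∀ t₀ : ℝ, |t₀ + 1| < ρ → ∀ y₀ : EuclideanSpace ℝ (Fin 3), y₀ 2 = 0 →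
            ∀ᶠ z in 𝓝 ((t₀, y₀) : ℝ × EuclideanSpace ℝ (Fin 3)), ∀ b : Fin 3, b ≠ 2 →
              fderiv ℝ (U z.1) z.2 (EuclideanSpace.single 2 1) b = μ z.1 (z.2 2) * fderiv ℝ (U z.1) z.2 (EuclideanSpace.single b 1) 2) →
          0 < r → 0 < δ → δ ≤ 1 / 4 →
          -- the STRAIGHT hot branch `s ↦ s • e` in frame form: horizontal unit direction, hot line, transversal curvature bound
          e 2 = 0 → e 0 ^ 2 + e 1 ^ 2 = 1 →
          (∀ s : ℝ, U (-1) (frameCLM e (s, (0 : ℝ), (0 : ℝ))) 2 = U (-1) 0 2) →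
          (∀ s : ℝ, κ ≤ -(fderiv ℝ (fderiv ℝ (fun y => σ * U (-1) y 2)) (frameCLM e (s, (0 : ℝ), (0 : ℝ))) (Jvec e) (Jvec e))) →
          -- (Q3∞), cold lateral values, hot centre, strict concavity, web Fermat law on the `δ`-box (frame form)
          (∀ τ z : ℝ, |τ| < δ → |z| < δ → ∀ s : ℝ,
            sSup ((fun n : ℝ => σ * U (-1 + τ) (frameCLM e (s, n, z)) 2) '' Set.Icc (-r) r) = R τ z) →
          (∀ τ z : ℝ, |τ| < δ → |z| < δ → ∀ s n : ℝ, (n = r ∨ n = -r) → σ * U (-1 + τ) (frameCLM e (s, n, z)) 2 < m) →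
          (∀ τ z : ℝ, |τ| < δ → |z| < δ → ∀ s : ℝ, m ≤ σ * U (-1 + τ) (frameCLM e (s, (0 : ℝ), z)) 2) →
          (∀ τ z : ℝ, |τ| < δ → |z| < δ → ∀ s : ℝ, ∀ n ∈ Set.Ioo (-r) r,
            fderiv ℝ (fderiv ℝ (fun y => σ * U (-1 + τ) y 2)) (frameCLM e (s, n, z)) (Jvec e) (Jvec e) < 0) →
          (∀ τ₀ z₀ : ℝ, |τ₀| < δ → |z₀| < δ → ∀ s₀ : ℝ, ∃ n₀ ∈ Set.Ioo (-r) r,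
            σ * U (-1 + τ₀) (frameCLM e (s₀, n₀, z₀)) 2 = R τ₀ z₀ ∧
            (∀ n ∈ Set.Icc (-r) r, n ≠ n₀ → σ * U (-1 + τ₀) (frameCLM e (s₀, n, z₀)) 2 < R τ₀ z₀) ∧
            DifferentiableAt ℝ (Function.uncurry R) (τ₀, z₀) ∧
            fderiv ℝ (Function.uncurry fun τ y => σ * U (-1 + τ) y 2) (τ₀, frameCLM e (s₀, n₀, z₀)) =
              (fderiv ℝ (Function.uncurry R) (τ₀, z₀)).comp
                ((ContinuousLinearMap.fst ℝ ℝ (EuclideanSpace ℝ (Fin 3))).prod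
                  ((EuclideanSpace.proj (2 : Fin 3)).comp (ContinuousLinearMap.snd ℝ ℝ (EuclideanSpace ℝ (Fin 3)))))) →
          -- THE SPACE–TIME WEB PACKAGE on the `δ′`-box (`…Q4TimeWebPackage.time_web_package_line`), webs parallel at `τ = 0`, negative slope on the box
          0 < δ' → δ' ≤ δ → δ' ≤ ρ → δ' < 1 / 2 →
          (∀ q : ℝ × ℝ × ℝ, |q.1| < δ' → |q.2.2| < δ' →
            n₀ q ∈ Set.Ioo (-r) r ∧
            σ * U (-1 + q.1) (frameCLM e (q.2.1, n₀ q, q.2.2)) 2 = R q.1 q.2.2 ∧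
            (∀ n ∈ Set.Icc (-r) r, n ≠ n₀ q → σ * U (-1 + q.1) (frameCLM e (q.2.1, n, q.2.2)) 2 < R q.1 q.2.2) ∧
            (∀ w : EuclideanSpace ℝ (Fin 3), w 2 = 0 → fderiv ℝ (fun y => U (-1 + q.1) y 2) (frameCLM e (q.2.1, n₀ q, q.2.2)) w = 0) ∧
            (∀ m : ℕ∞, ContDiffAt ℝ m n₀ q) ∧
            0 < κt q.1 q.2.2 ∧
            fderiv ℝ (fderiv ℝ (fun y => σ * U (-1 + q.1) y 2)) (frameCLM e (q.2.1, n₀ q, q.2.2)) e e +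
                fderiv ℝ (fderiv ℝ (fun y => σ * U (-1 + q.1) y 2)) (frameCLM e (q.2.1, n₀ q, q.2.2)) (Jvec e) (Jvec e) =
              -κt q.1 q.2.2 ∧
            κt q.1 q.2.2 * (fderiv ℝ n₀ q ((0 : ℝ), (0 : ℝ), (1 : ℝ))) ^ 2 =
              (deriv (deriv (R q.1)) q.2.2 - μ (-1 + q.1) q.2.2 * κt q.1 q.2.2) * (1 + (fderiv ℝ n₀ q ((0 : ℝ), (1 : ℝ), (0 : ℝ))) ^ 2)) →
          (∀ s z : ℝ, |z| < δ' → n₀ ((0 : ℝ), s, z) = n₀ ((0 : ℝ), (0 : ℝ), z)) →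
          (∀ τ z : ℝ, |τ| < δ' → |z| < δ' → μ (-1 + τ) z < 0) →
          -- CASE II, SHARPENED (`…WebPackageAnalytic.eventually_nonsonic_of_package`): a PUNCTURED WINDOW of non-sonic times around `τ = 0` …
          (∃ δ'' : ℝ, 0 < δ'' ∧ ∀ τ : ℝ, 0 < |τ| → |τ| < δ'' → ¬ (∃ a b : ℝ, ∀ z : ℝ, |z| < δ → R τ z = a + b * z)) →
          -- … and at every non-sonic time of the box the base web is NOT an `e`-parallel line (the LINE lever `…LineLeverAtTime`)
          (∀ τ : ℝ, |τ| < δ' → ¬ (∃ a b : ℝ, ∀ z : ℝ, |z| < δ → R τ z = a + b * z) →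
            ∃ s : ℝ, n₀ (τ, s, (0 : ℝ)) ≠ n₀ (τ, (0 : ℝ), (0 : ℝ))) →
          False := by
  intro C σ κ ρ δ' r δ m U R μ e n₀ κt hUrate hUcont hUmild hUdiv hUpol _hUne _hUhotbd _hUflat _hUtime _hUpeak _hUcrit _hbil _hUcurl hσ _hσN _hκ hμ3 _hρ
    _hρ1 hslabU _hevU _hr hδ hδ4 he2 hunit _hhotline _hcurvF _hQ3F _hcoldF _hhotF hconcF hwebF hδ'pos hδ'δ hδ'ρ hδ'h hpack hpar0 hμnegB hsharp hunpin
  /- the B-TWPc package in one call -/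
  obtain ⟨τs, hτs, hτsδ', hT5⟩ := curved_timeWeb_at hUrate hUcont hUmild hUdiv hμ3 hslabU he2 hunit hδ'δ hδ'ρ hδ'h hconcF hpack hδ hδ'pos hpar0 hμnegB hunpin
  obtain ⟨δ'', hδ'', hns⟩ := hsharp
  -- the base time
  set τ₁ : ℝ := min τs δ'' / 2 with hτ₁_def
  have hm : 0 < min τs δ'' := lt_min hτs hδ''
  have hτ₁pos : 0 < τ₁ := by rw [hτ₁_def]; linarith
  have hτ₁abs : |τ₁| = τ₁ := abs_of_pos hτ₁pos
  have hτ₁s : |τ₁| < τs := by rw [hτ₁abs, hτ₁_def]; linarith [min_le_left τs δ'']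
  have hτ₁'' : |τ₁| < δ'' := by rw [hτ₁abs, hτ₁_def]; linarith [min_le_right τs δ'']
  have hτ₁δ' : |τ₁| < δ' := lt_of_lt_of_le hτ₁s hτsδ'
  have hτ₁δ : |τ₁| < δ := lt_of_lt_of_le hτ₁δ' hδ'δ
  have hnsτ : ¬ (∃ a b : ℝ, ∀ z : ℝ, |z| < δ → R τ₁ z = a + b * z) := hns τ₁ (by rw [hτ₁abs]; exact hτ₁pos) hτ₁''
  obtain ⟨-, Γ, φ, k₁, ⟨hΓcd, -, hk₁, -, hφsurj, -, -, hΓφ, hΓ2, -, hΓunit, -, hfrenet⟩, hJ3, hloc⟩ := hT5 τ₁ hτ₁s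
  -- analyticity of the ridge height at `τ₁`, positivity of `κt`
  have hweb : ∀ τ z : ℝ, |τ| < δ → |z| < δ → ∀ s : ℝ, ∃ n₁ ∈ Ioo (-r) r, σ * U (-1 + τ) (frameCLM e (s, n₁, z)) 2 = R τ z ∧
      ∀ n ∈ Icc (-r) r, n ≠ n₁ → σ * U (-1 + τ) (frameCLM e (s, n, z)) 2 < R τ z := by
    intro τ z hτ hz s
    obtain ⟨n₁, hn₁, h1, h2, -, -⟩ := hwebF τ z hτ hz s
    exact ⟨n₁, hn₁, h1, h2⟩
  have hRan : AnalyticOnNhd ℝ (R τ₁) (Ioo (-δ) δ) :=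
    ridgeHeight_analyticOnNhd_height hUrate hUcont hUmild hUdiv (by linarith) hconcF hweb hτ₁δ
  have hκt : ∀ τ z : ℝ, |τ| < δ' → |z| < δ' → 0 < κt τ z := fun τ z h1 h2 => (hpack (τ, (0 : ℝ), z) h1 h2).2.2.2.2.2.1
  /- STEP 1: `k₁′ ≡ 0` -/
  have hk₁' : ∀ σ₀ : ℝ, deriv k₁ σ₀ = 0 := by
    intro σ₀
    obtain ⟨ε₁, hε₁, G₁, Sq, hG, -, hq, hparr, ε₂, hε₂, hε₂₁, htrans⟩ := hloc σ₀
    exact curvature_deriv_zero_at hUrate hUcont hUmild hUdiv hUpol hμ3 hslabU hσ hδ hδ'ρ hδ'h hκt hμnegB hτ₁δ' hRan hnsτ hΓcd hΓ2 hΓunit hk₁ hfrenet hε₁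
      hG hq hparr hε₂ hε₂₁ htrans
  /- STEP 2: constant curvature; not a circle; hence `k₁ ≡ 0` -/
  have hk₁const : ∀ s, k₁ s = k₁ 0 := fun s =>
    is_const_of_deriv_eq_zero (hk₁.differentiable (by simp)) hk₁' s 0
  have hk₁zero : ∀ s, k₁ s = 0 := by
    have hΓC2 : ContDiff ℝ 2 Γ := hΓcd.of_le (by norm_cast)
    rcases line_or_circle_of_constant_curvature hΓC2 hΓ2 hΓunit (k₀ := k₁ 0) (fun s => by rw [hfrenet s, hk₁const s]) with ⟨h0, -⟩ | ⟨-, p, -, hcirc⟩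
    · intro s; rw [hk₁const s, h0]
    · exfalso
      -- on a circle `‖Γ‖` is bounded, but `⟪Γ s, e⟫ = φ s` is onto `ℝ`
      have hbdd : ∀ s, ‖Γ s‖ ≤ |k₁ 0|⁻¹ + ‖p‖ := fun s => by
        have h1 : ‖Γ s‖ ≤ ‖Γ s - p‖ + ‖p‖ := by have := norm_add_le (Γ s - p) p; simpa using this
        rw [hcirc s] at h1; exact h1
      set B : ℝ := |k₁ 0|⁻¹ + ‖p‖ with hB
      have hB0 : 0 ≤ B := by positivity
      obtain ⟨s, hs⟩ := hφsurj (B + 1)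
      have hΓs := hΓφ s
      have hc0 : Γ s 0 = φ s * e 0 - n₀ (τ₁, φ s, 0) * e 1 := by
        rw [hΓs]; simp [Jvec]; ring
      have hc1 : Γ s 1 = φ s * e 1 + n₀ (τ₁, φ s, 0) * e 0 := by
        rw [hΓs]; simp [Jvec]
      have hproj : e 0 * Γ s 0 + e 1 * Γ s 1 = φ s := by
        rw [hc0, hc1]; linear_combination φ s * hunit
      have hnorm : Γ s 0 ^ 2 + Γ s 1 ^ 2 ≤ B ^ 2 := by
        have h := norm_sq_eq_sum3 (Γ s)
        have hb := hbdd s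
        have hnn := norm_nonneg (Γ s)
        nlinarith [sq_nonneg (Γ s 2)]
      have hCS : (e 0 * Γ s 0 + e 1 * Γ s 1) ^ 2 ≤ Γ s 0 ^ 2 + Γ s 1 ^ 2 := by
        nlinarith [sq_nonneg (e 0 * Γ s 1 - e 1 * Γ s 0), hunit]
      rw [hproj, hs] at hCS
      have h1 : (B + 1) ^ 2 ≤ B ^ 2 := hCS.trans hnorm
      have h2 : (B + 1) ^ 2 = B ^ 2 + 2 * B + 1 := by ring
      rw [h2] at h1
      linarith
  /- STEP 3: J3 pins the base web — contradiction with the LINE lever at the non-sonic time `τ₁` -/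
  obtain ⟨s, hs⟩ := hunpin τ₁ hτ₁δ' hnsτ
  exact hs (hJ3 hk₁zero s)

end Summit.NavierStokesRegularity.NavierStokesRegularity.Theorems.PoloidalWindowDoorLrcModEntireCurvedEndTower

end
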